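import Summits.HodgeConjecture.Ring2.LowDimensionHodgeOfMarkman
import HarnessLib

/-!
# The Hodge conjecture in dimension `≤ 5` granted Markman's fourfold theorem — CM-first form: simple CM fourfold factors absorbed

Cell `pub-hodge-ring2` (HONEST FRAMING: research route conditional on HC_CM; not a corollary; Q11.4-sentence-2 already
refuted in dim ≥ 3), Literature lane (lit seat, generation 63, programme R35-B). Sequel of
`Ring2/LowDimensionHodgeOfMarkman` (R35: every non-simple fourfold; non-simple fivefolds without simple fourfold factor and
outside case (e) ∩ (a1) — all GRANTED the tree's named fact `Markman2025_weilClasses_algebraic_abelianFourfold` = `hMark`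
ALONE, HC_CM in dimension `≤ 5` being a consequence of `hMark` in the tree). Theorems only (no definition, no named fact,
no `sorry`); NEW as a conditional census, hence under `Summits/`.

WHAT THIS FILE ADDS. The residual row «a simple fourfold isogeny factor» of R35 shrinks to «a simple fourfold isogeny
factor NOT of CM type»: for `X ∼ C × F` with `F` a simple CM fourfold and `C` a curve (the complement of `F`, R35 §1),
either `C` is of CM type — then `X` is a CM fivefold (`CMWeights.hodgeConjectureFor_of_isOfCMType_dim_le_five_of_markman`)
— or `End⁰(C) = ℚ` (`finrank_endAlgebra_eq_one_of_curve_of_not_isOfCMType`), and then Moonen–Zarhin's Thm. (3.2)(2)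
(«Suppose `X₁` has no factors of Type 4 and `X₂` is of CM-type. Then …», Math. Ann. 315 (1999) §3) — PROVED in the tree
as `hodgeClassesProductSpan_of_hasNoTypeIVFactor_of_isOfCMType`, with the span fact `Lombardo2016_hodgeClassesProductSpan_holds`
discharged, packaged as `hodgeConjectureFor_prod_iff_of_hasNoTypeIVFactor_of_isOfCMType` — splits the Hodge classes of
`C × F`, so `HC(C × F)` is `HC(C)` (dimension `1`, unconditional) and `HC(F)` (a CM fourfold, granted `hMark`).
* `hodgeConjectureFor_curve_prod_of_isOfCMType_of_markman` — `HC(C × F)`, `C` a curve, `F` of CM type of dimension `≤ 4`;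
* `hodgeConjectureFor_of_avDominatedBy_cmFourfold_of_dim_eq_five_of_markman` — fivefolds with a CM fourfold factor;
* **`hodgeConjectureFor_of_dim_eq_five_of_markman`** — THE FIVEFOLD CENSUS, CM-first: residual hypotheses (i) simple ⟹ of
  CM type [Tankeev–Ribet, a named fact of the tree], (ii) simple fourfold FACTORS ⟹ of CM type [Moonen–Zarhin 1995 and
  Thm. 0.2 (3)–(4) with a non-CM simple fourfold], (iii) not the row `X ∼ E² × T`, `T` a simple threefold with
  `dim_ℚ End⁰(T) = 2`, `End⁰(E) ↪ End⁰(T)` [Thm. 0.2 (1)];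
* **`hodgeConjectureFor_of_dim_le_five_of_markman'`** — dimension `≤ 5`, and the class target
  **`hcOnClass_dim_le_five_of_markman'`** with its on-path lemma.
Nothing here discharges `hMark`; nothing is said about `D² ≠ B²`.

## References
* [MoonenZarhin1999LowDim] B. Moonen, Yu. Zarhin, Math. Ann. 315 (1999) 711–733: Thm. 0.1, Thm. 0.2, case (g), §3 Thm. (3.2)(2)
  [corpus: paper:arxiv-math_9901113 p0001, p0006]. [cite: MoonenZarhin1999LowDim, Thm. 0.2 and §3 Thm. (3.2)(2)]
* [Lombardo2016] D. Lombardo, Ann. Inst. Fourier 66 (2016), Lemma 3.4 (p. 1229) (the span fact, discharged in the tree).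
  [cite: Lombardo2016, Lemma 3.4 (p. 1229)]
* [MumfordAV1970] D. Mumford, *Abelian Varieties* (1970), §19 Thm. 1 (pp. 173–174). [cite: MumfordAV1970, §19 Thm. 1 (pp. 173–174)]
* [Milne1999] J. S. Milne, Compositio Math. 117 (1999), §2 p. 54. [cite: Milne1999, §2 p. 54]
* [Markman2025SurveySecant] E. Markman, arXiv:2509.23403, Thm. 1.2 and Cor. 1.3. [claim: Markman2025SurveySecant, status: under-review]
* [Deligne2000] P. Deligne, *The Hodge conjecture* (Clay, 2000), §1. [cite: Deligne2000, §1]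
-/

noncomputable section

open CategoryTheory CategoryTheory.Limits

namespace Summit.HodgeConjecture.Ring2.LowDimOfMarkman

open Literature.AlgebraicGeometry.Motives (AbelianVariety)
open Literature.AlgebraicGeometry.Motives.AbelianVariety
open Literature.AlgebraicGeometry.HodgeTheory
open Literature.AlgebraicGeometry.ComplexMultiplication
open Literature.AlgebraicGeometry.Milne1999
open Summit.HodgeConjecture.CorCM.Domination
open Summit.HodgeConjecture.CorCM.CMWeights (hodgeConjectureFor_of_isOfCMType_dim_le_five_of_markman)
open Summit.HodgeConjecture.HodgeConjecture.Ring2.ClassTargets (HCOnClass)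

variable {X : AbelianVariety ℂ}

/-! ### §1 Simple fourfold factors of CM type; §2 the CM-first census

The residual row «a simple fourfold isogeny factor» of the prequel (§4–§5 there) shrinks to «a simple fourfold isogeny factor NOT of CM
type»: for `X ∼ C × F` with `F` a simple CM fourfold and `C` a curve, either `C` is of CM type (then `X` is a CM
fivefold) or `End⁰(C) = ℚ`, and then Moonen–Zarhin's Thm. (3.2)(2) («Suppose `X₁` has no factors of Type 4 and `X₂` is
of CM-type») — PROVED in the tree as `hodgeClassesProductSpan_of_hasNoTypeIVFactor_of_isOfCMType` (span fact
`Lombardo2016_hodgeClassesProductSpan_holds` discharged) — splits the Hodge classes of `C × F`, so `HC(C × F)` is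
`HC(C)` (dimension `1`) and `HC(F)` (a CM fourfold, granted `hMark`). -/

/-- **`HC(C × F)` for a curve `C` and an abelian variety `F` of CM type of dimension `≤ 4`, granted Markman's theorem
alone.** `C` of CM type: `C × F` is of CM type of dimension `≤ 5` (`CMWeights`); `C` not of CM type: `End⁰(C) = ℚ`
(`finrank_endAlgebra_eq_one_of_curve_of_not_isOfCMType`), so `C` has no factor of type IV and Thm. (3.2)(2) applies
(`hodgeConjectureFor_prod_iff_of_hasNoTypeIVFactor_of_isOfCMType`), with `HC(C)` unconditional and `HC(F)` from
`hMark`. [cite: MoonenZarhin1999LowDim, §3 Thm. (3.2)(2)] [cite: Lombardo2016, Lemma 3.4 (p. 1229)]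
[claim: Markman2025SurveySecant, status: under-review] -/
theorem hodgeConjectureFor_curve_prod_of_isOfCMType_of_markman {C F : AbelianVariety ℂ}
    (hMark : Markman2025_weilClasses_algebraic_abelianFourfold) (hC : C.dim = 1) (hF : IsOfCMType F)
    (hF4 : F.dim ≤ 4) : HodgeConjectureFor (C.prod F).dim (C.prod F).X := by
  by_cases hCcm : IsOfCMType C
  · exact hodgeConjectureFor_of_isOfCMType_dim_le_five_of_markman hMark (C.prod F) (hCcm.prod hF)
      (by rw [dim_prod]; omega)
  · exact (hodgeConjectureFor_prod_iff_of_hasNoTypeIVFactor_of_isOfCMType C F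
      (hasNoTypeIVFactor_of_finrank_endAlgebra_eq_one (finrank_endAlgebra_eq_one_of_curve_of_not_isOfCMType hC hCcm))
      hF).2
      ⟨hodgeConjectureFor_of_dim_le_three_holds (by omega) isSmoothProjective_holds,
        hodgeConjectureFor_of_isOfCMType_dim_le_five_of_markman hMark F hF (by omega)⟩

/-- **A fivefold with a simple isogeny factor `F` of dimension `4` OF CM TYPE satisfies the Hodge conjecture, granted
Markman's theorem** (`X ∼ F × C` with `C` a curve, §1; then the previous theorem on `C × F`).
[cite: MoonenZarhin1999LowDim, Thm. 0.2 (3)–(4) with case (g) and §3 Thm. (3.2)(2)] [cite: MumfordAV1970, §19 Thm. 1 (pp. 173–174)]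
[claim: Markman2025SurveySecant, status: under-review] -/
theorem hodgeConjectureFor_of_avDominatedBy_cmFourfold_of_dim_eq_five_of_markman {F : AbelianVariety ℂ}
    (hMark : Markman2025_weilClasses_algebraic_abelianFourfold) (hX5 : X.dim = 5) (hF4 : F.dim = 4)
    (hFcm : IsOfCMType F) (hFX : AVDominatedBy F X) : HodgeConjectureFor X.dim X.X := by
  obtain ⟨C, hdim, hFC⟩ := exists_prod_isIsogenous_of_avDominatedBy hFX
  exact HodgeConjectureFor.of_isIsogenous (hFC.symm'.trans (isIsogenous_prod_comm F C))
    (hodgeConjectureFor_curve_prod_of_isOfCMType_of_markman hMark (by omega) hFcm hF4.le)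

/-- **THE HODGE CONJECTURE FOR COMPLEX ABELIAN FIVEFOLDS, GRANTED MARKMAN'S THEOREM — CM-first form.** For a fivefold
`X`: if `X` is simple, assume it is of CM type [residual: Tankeev–Ribet]; assume every SIMPLE FOURFOLD isogeny factor
of `X` is of CM type [residual: Moonen–Zarhin 1995 and Thm. 0.2 (3)–(4) with a non-CM simple fourfold]; assume `X` is
not `∼ E² × T` with `T` a simple threefold, `dim_ℚ End⁰(T) = 2`, `End⁰(E) ↪ End⁰(T)` [residual: Thm. 0.2 (1)]. Then
the Hodge conjecture holds for `X`. [cite: MoonenZarhin1999LowDim, Thm. 0.2] [cite: Milne1999, §2 p. 54]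
[claim: Markman2025SurveySecant, status: under-review] -/
theorem hodgeConjectureFor_of_dim_eq_five_of_markman (hMark : Markman2025_weilClasses_algebraic_abelianFourfold)
    (hX5 : X.dim = 5) (hs : X.IsSimple → IsOfCMType X)
    (h4 : ∀ F : AbelianVariety ℂ, F.IsSimple → F.dim = 4 → AVDominatedBy F X → IsOfCMType F)
    (hne : ¬ ∃ E T : AbelianVariety ℂ, E.dim = 1 ∧ IsOfCMType E ∧ T.IsSimple ∧ T.dim = 3 ∧
      Module.finrank ℚ T.endAlgebra = 2 ∧ Nonempty (E.endAlgebra →+* T.endAlgebra) ∧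
      AbelianVariety.IsIsogenous X (E.prod (E.prod T))) :
    HodgeConjectureFor X.dim X.X := by
  by_cases hX : X.IsSimple
  · exact hodgeConjectureFor_of_isOfCMType_dim_le_five_of_markman hMark X (hs hX) (by omega)
  by_cases hF : ∃ F : AbelianVariety ℂ, F.IsSimple ∧ F.dim = 4 ∧ AVDominatedBy F X
  · obtain ⟨F, hFs, hF4, hFX⟩ := hF
    exact hodgeConjectureFor_of_avDominatedBy_cmFourfold_of_dim_eq_five_of_markman hMark hX5 hF4 (h4 F hFs hF4 hFX) hFX
  · push Not at hF
    exact hodgeConjectureFor_of_dim_eq_five_of_not_isSimple_of_markman hMark hX5 hX hF hne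

/-- **THE HODGE CONJECTURE IN DIMENSION `≤ 5`, GRANTED MARKMAN'S THEOREM, OUTSIDE THREE RESIDUAL ROWS** (CM-first form of
`hodgeConjectureFor_of_dim_le_five_of_markman`): (i) simple of dimension `4` or `5` ⟹ of CM type; (ii) in dimension
`5`, simple fourfold isogeny factors are of CM type; (iii) in dimension `5`, not the row `E² × T` with
`dim_ℚ End⁰(T) = 2`. [cite: MoonenZarhin1999LowDim, Thm. 0.1 and Thm. 0.2] [claim: Markman2025SurveySecant, status: under-review]
[cite: Deligne2000, §1] -/
theorem hodgeConjectureFor_of_dim_le_five_of_markman' (hMark : Markman2025_weilClasses_algebraic_abelianFourfold)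
    (h5 : X.dim ≤ 5) (hs : 4 ≤ X.dim → X.IsSimple → IsOfCMType X)
    (h4 : X.dim = 5 → ∀ F : AbelianVariety ℂ, F.IsSimple → F.dim = 4 → AVDominatedBy F X → IsOfCMType F)
    (hne : X.dim = 5 → ¬ ∃ E T : AbelianVariety ℂ, E.dim = 1 ∧ IsOfCMType E ∧ T.IsSimple ∧ T.dim = 3 ∧
      Module.finrank ℚ T.endAlgebra = 2 ∧ Nonempty (E.endAlgebra →+* T.endAlgebra) ∧
      AbelianVariety.IsIsogenous X (E.prod (E.prod T))) :
    HodgeConjectureFor X.dim X.X := by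
  rcases (show X.dim ≤ 4 ∨ X.dim = 5 by omega) with h4' | h5'
  · exact hodgeConjectureFor_of_dim_le_five_of_markman hMark h5 hs (fun h => absurd h (by omega))
      (fun h => absurd h (by omega))
  · exact hodgeConjectureFor_of_dim_eq_five_of_markman hMark h5' (hs (by omega)) (h4 h5') (hne h5')

/-- **Class target (CM-first form)**: the Hodge conjecture on the class of complex abelian varieties of dimension
`≤ 5` outside the three residual rows, from Markman's fourfold theorem alone. [cite: MoonenZarhin1999LowDim, Thm. 0.1 and Thm. 0.2]
[cite: Deligne2000, §1] [claim: Markman2025SurveySecant, status: under-review] -/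
theorem hcOnClass_dim_le_five_of_markman' (hMark : Markman2025_weilClasses_algebraic_abelianFourfold) :
    HCOnClass fun X => X.dim ≤ 5 ∧ (4 ≤ X.dim → X.IsSimple → IsOfCMType X) ∧
      (X.dim = 5 → ∀ F : AbelianVariety ℂ, F.IsSimple → F.dim = 4 → AVDominatedBy F X → IsOfCMType F) ∧
      (X.dim = 5 → ¬ ∃ E T : AbelianVariety ℂ, E.dim = 1 ∧ IsOfCMType E ∧ T.IsSimple ∧ T.dim = 3 ∧
        Module.finrank ℚ T.endAlgebra = 2 ∧ Nonempty (E.endAlgebra →+* T.endAlgebra) ∧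
        AbelianVariety.IsIsogenous X (E.prod (E.prod T))) :=
  fun _ ⟨h5, hs, h4, hne⟩ => hodgeConjectureFor_of_dim_le_five_of_markman' hMark h5 hs h4 hne

/-- **On path** (CM-first class): a case of the summit. [cite: Deligne2000, §1] -/
theorem hcOnClass_dim_le_five_of_hodgeConjecture'
    (h : ∀ ⦃n : ℕ⦄ ⦃Y : Literature.AlgebraicGeometry.Motives.SchemeOver ℂ⦄,
      Literature.AlgebraicGeometry.Motives.IsSmoothProjective n Y → HodgeConjectureFor n Y) :
    HCOnClass fun X => X.dim ≤ 5 ∧ (4 ≤ X.dim → X.IsSimple → IsOfCMType X) ∧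
      (X.dim = 5 → ∀ F : AbelianVariety ℂ, F.IsSimple → F.dim = 4 → AVDominatedBy F X → IsOfCMType F) ∧
      (X.dim = 5 → ¬ ∃ E T : AbelianVariety ℂ, E.dim = 1 ∧ IsOfCMType E ∧ T.IsSimple ∧ T.dim = 3 ∧
        Module.finrank ℚ T.endAlgebra = 2 ∧ Nonempty (E.endAlgebra →+* T.endAlgebra) ∧
        AbelianVariety.IsIsogenous X (E.prod (E.prod T))) :=
  fun _ _ => h isSmoothProjective_holds

end Summit.HodgeConjecture.Ring2.LowDimOfMarkman

end
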